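import Literature.Probability.ImportanceSampling.DefensiveMixture
import Literature.Probability.StratifiedSampling.OptimumAllocation
import HarnessLib

/-!
# Weight optimisation in multichannel Monte Carlo (Kleiss–Pittau 1994): `W(α)`, the channel moments `W_i(α) = −∂W/∂α_i`, Euler's identity, the stationarity condition `W_i(ᾱ) = W(ᾱ)` as a certificate of GLOBAL optimality, the discrepancy bound `W(α) − W(α′) ≤ D`, and the dependent case `f = Σ γ_i g_i`

Topic `Literature/Probability/ImportanceSampling`; finite sample space, one-draw (population) moments, vocabulary of
`OptimalImportanceDistribution.lean` (`isSecondMoment`, `isMean`, `isVariance`, `Admissible`) and `DefensiveMixture.lean` (`mixture α Q` =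
the multichannel density `g = Σ_i α_i g_i`). PUBLISHED statements with our proofs + labelled elementary consequences; no named fact is
introduced. independent recomputation; certified where stated, statistical where stated; no new-physics claim. (Filed by the pub-qed
literature seat gen 23 for the IR/SE lane's channel-weight tuning: `irse/IDEAS-sampler.md` S1–S3, `irse/B-SAMPLER-DESIGN.md` §2.5 channel
probabilities `c_k`; VALUE-FREE.)

Source [KleissPittau1994]: R. Kleiss, R. Pittau, "Weight optimization in multichannel Monte Carlo", Comput. Phys. Commun. 83 (1994)
141–146 = arXiv:hep-ph/9405257 (`lit read arxiv:hep-ph/9405257`, §§1–2), VERBATIM: "Each density g_i is of course nonegative and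
normalized to unity: ∫ g_i(x) dx = 1. The a-priori weights are denoted by α_i, and also these must be a partition of unity: α_i ≥ 0 and
Σ_{i=1}^n α_i = 1. If the channels are picked at random, with probability α_i for channel i, the total probability density of the
obtained sample of x values is g(x) = Σ_{i=1}^n α_i g_i(x) … The weight assigned to each Monte Carlo point must, then, be
w(x) = f(x)/g(x). The expectation value of the result of this Monte Carlo integration, and its variance, then follow from
I = ⟨w⟩_g = ∫ dx g(x) w(x) = ∫ dx f(x), W(α) = ⟨w(x)²⟩_g = ∫ dx g(x) w(x)² = ∫ dx f(x)²/g(x). … The expected error of the integration,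
for N points, is [(W(α) − I²)/N]^{1/2}. It is the quantity W(α) that we may try to minimize by adjustment of the α_i. … The extremum of
W(α) (homogeneous of degree −1 in the α_i) on the simplex described by the α_i is obtained for those values ᾱ for which W_i(ᾱ) = W(ᾱ)
for all i, where W_i(α) ≡ −∂W(α)/∂α_i = ∫ dx f(x)² g_i(x)/g(x)². That this extremum is, indeed, a minimum can be proven simply. For let
α_i = ᾱ_i + β_i, where β_i is small. Then, Σ_i β_i = 0, and we have W(α) = W(ᾱ) + ½ ∫ dx f(x)² (Σ_i β_i g_i(x))²/ḡ(x)³ + O(β³). In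
general, we cannot prove that the minimum is unique. It is interesting to study some simple cases. In the first place, suppose that
f(x) is dependent with the set g_i(x), that is, there are constants γ_i ≥ 0 such that f(x) = Σ_i γ_i g_i(x). We then have ∫ dx f(x) =
Σ_i γ_i, and the minimum for W(α) is reached at ᾱ_k = γ_k/Σ_i γ_i, in which case W_k(α) = W(α) = (Σ_i γ_i)². Of course, in this case
the Monte Carlo error is zero." §2: "estimate the W_i(α), using W_i(α) = ⟨w(x)² g_i(x)/g(x)⟩_g. … the choice of new α_i according to
α_i^{new} ∝ α_i √(W_i(α)), will give immediately the optimal set ᾱ [in the stratified case]"; §3: "we compute a measure of the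
disrepancy between the values of the … different W_i(α): D = max_{i,j} |W_i − W_j|. Hence, D measures how well the set of α_i
approximates the behaviour of the optimal set."

TYPING (finite `Ω`; the paper's `f` is our `Z·P` — integrand times nominal weight — so that `W(α) = isSecondMoment P (mixture α Q) Z`
= `Σ_x (f p)²/g_α` by `isSecondMoment_eq`, and `I = Σ_x Z P`): `channelMoment α Q P Z i = Σ_x (Z P)² Q_i / g_α²` is `W_i(α)`.
PROVED, as printed: Euler's identity for the degree −1 homogeneous `W`, `Σ_i α_i W_i(α) = W(α)` (`sum_mul_channelMoment`); the §2
estimator form `W_i(α) = ⟨w² g_i/g⟩_g` (`channelMoment_eq_expectation`); the dependent case `f = Σ γ_i g_i`: at `ᾱ = γ/Σγ`,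
`W(ᾱ) = (Σγ)²`, `W_k(ᾱ) = (Σγ)²` for every channel with `γ_k > 0`, and zero variance (`isSecondMoment_dependent`,
`channelMoment_dependent`, `isVariance_dependent`). PROVED, elementary consequences NOT printed in this form (the paper proves a LOCAL
minimum by the second-order expansion and says nothing global): `W` lies above its tangent planes — `W(α′) ≥ 2W(α) − Σ_i α′_i W_i(α)`
for every admissible `α′` in the simplex (`isSecondMoment_mixture_ge_tangent`, from `(g − g′)² ≥ 0`), hence **the printed stationarity
condition certifies a GLOBAL minimum**: `W_i(α) ≤ W(α) ∀ i ⇒ W(α) ≤ W(α′)` (`isSecondMoment_le_of_channelMoment_le`), and the printed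
discrepancy `D` bounds the sub-optimality: `|W_i(α) − W_j(α)| ≤ D ∀ i,j ⇒ W(α) − W(α′) ≤ D` (`isSecondMoment_sub_le_discrepancy`). -/

namespace Literature.Probability.ImportanceSampling

open Finset

variable {Ω : Type*} [Fintype Ω] {ι : Type*} [Fintype ι]

section KleissPittau

/-- `W_i(α) = −∂W/∂α_i = ∫ f² g_i / g²` — the channel moment (finite `Ω`, `f = Z·P`, `g = mixture α Q`; Lean's `x/0 = 0` off the
support of `g`). [cite: KleissPittau1994, §1 (display defining W_i(α))] -/
noncomputable def channelMoment (α : ι → ℝ) (Q : ι → Ω → ℝ) (P Z : Ω → ℝ) (i : ι) : ℝ :=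
  ∑ ω, (Z ω * P ω) ^ 2 * Q i ω / mixture α Q ω ^ 2

/-- Unfolding lemma for `channelMoment`. [cite: KleissPittau1994, §1 (display defining W_i(α))] -/
theorem channelMoment_def (α : ι → ℝ) (Q : ι → Ω → ℝ) (P Z : Ω → ℝ) (i : ι) :
    channelMoment α Q P Z i = ∑ ω, (Z ω * P ω) ^ 2 * Q i ω / mixture α Q ω ^ 2 := rfl

variable {α α' : ι → ℝ} {Q : ι → Ω → ℝ} {P Z : Ω → ℝ}

omit [Fintype Ω] in
/-- `g_α ≥ 0` for non-negative weights and channels (plumbing). [folklore] -/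
private theorem mixture_nonneg' (hα : ∀ k, 0 ≤ α k) (hQ : ∀ k ω, 0 ≤ Q k ω) (ω : Ω) : 0 ≤ mixture α Q ω := by
  rw [mixture_def]
  exact Finset.sum_nonneg fun k _ => mul_nonneg (hα k) (hQ k ω)

/-- **"homogeneous of degree −1": Euler's identity** `Σ_i α_i W_i(α) = W(α)`. [cite: KleissPittau1994, §1 ("The extremum of W(α) (homogeneous of degree −1 in the α_i) …")] -/
theorem sum_mul_channelMoment (α : ι → ℝ) (Q : ι → Ω → ℝ) (P Z : Ω → ℝ) :
    ∑ i, α i * channelMoment α Q P Z i = isSecondMoment P (mixture α Q) Z := by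
  rw [isSecondMoment_eq]
  simp only [channelMoment, Finset.mul_sum]
  rw [Finset.sum_comm]
  refine Finset.sum_congr rfl fun ω _ => ?_
  have h : ∑ i, α i * ((Z ω * P ω) ^ 2 * Q i ω / mixture α Q ω ^ 2)
      = (Z ω * P ω) ^ 2 * mixture α Q ω / mixture α Q ω ^ 2 := by
    rw [mixture_def, Finset.mul_sum, Finset.sum_div]
    exact Finset.sum_congr rfl fun i _ => by ring
  rw [h]
  by_cases hq : mixture α Q ω = 0
  · rw [hq]; simp
  · rw [pow_two (mixture α Q ω), mul_div_mul_right _ _ hq]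

/-- **The §2 estimator form** `W_i(α) = ⟨w(x)² g_i(x)/g(x)⟩_g` (an expectation under `g`, so it is measurable on the fly).
[cite: KleissPittau1994, §2 (display "W_i(α) = ⟨w(x)² g_i(x)/g(x)⟩")] -/
theorem channelMoment_eq_expectation (α : ι → ℝ) (Q : ι → Ω → ℝ) (P Z : Ω → ℝ) (i : ι) :
    channelMoment α Q P Z i
      = ∑ ω, mixture α Q ω * ((Z ω * P ω / mixture α Q ω) ^ 2 * (Q i ω / mixture α Q ω)) := by
  unfold channelMoment
  refine Finset.sum_congr rfl fun ω _ => ?_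
  by_cases hq : mixture α Q ω = 0
  · rw [hq]; simp
  · field_simp

/-- The tangent-line inequality of the convex function `1/g`: `c/g′ ≥ 2c/g − c g′/g²` for `c ≥ 0`, `g ≥ 0`, `g′ > 0` (plumbing). [folklore] -/
private theorem tangent_ineq {c g g' : ℝ} (hc : 0 ≤ c) (hg : 0 ≤ g) (hg' : 0 < g') :
    2 * (c / g) - c * g' / g ^ 2 ≤ c / g' := by
  by_cases hg0 : g = 0
  · rw [hg0]; simp; positivity
  · have hgpos : 0 < g := lt_of_le_of_ne hg (Ne.symm hg0)
    have key : c / g' - (2 * (c / g) - c * g' / g ^ 2) = c * (g - g') ^ 2 / (g' * g ^ 2) := by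
      field_simp
      ring
    have hnn : 0 ≤ c * (g - g') ^ 2 / (g' * g ^ 2) := by positivity
    linarith

/-- **`W` lies above its tangent planes** (convexity of `1/g`; elementary, NOT printed — the paper gives the local second-order expansion):
for weights `α, α′ ≥ 0`, channels `g_k ≥ 0`, and `g_{α′}` charging every point where `f ≠ 0`,
`W(α′) ≥ 2 W(α) − Σ_i α′_i W_i(α)`. [cite: KleissPittau1994, §1 ("W(α) = W(ᾱ) + ½∫ f²(Σβ_i g_i)²/ḡ³ + O(β³)")] -/
theorem isSecondMoment_mixture_ge_tangent (hα : ∀ k, 0 ≤ α k) (hα' : ∀ k, 0 ≤ α' k) (hQ : ∀ k ω, 0 ≤ Q k ω)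
    (hadm' : Admissible P (mixture α' Q) Z) :
    2 * isSecondMoment P (mixture α Q) Z - ∑ i, α' i * channelMoment α Q P Z i
      ≤ isSecondMoment P (mixture α' Q) Z := by
  -- Σ_i α'_i W_i(α) = Σ_ω (ZP)² g_{α'} / g_α²
  have hlin : ∑ i, α' i * channelMoment α Q P Z i = ∑ ω, (Z ω * P ω) ^ 2 * mixture α' Q ω / mixture α Q ω ^ 2 := by
    simp only [channelMoment, Finset.mul_sum]
    rw [Finset.sum_comm]
    refine Finset.sum_congr rfl fun ω _ => ?_
    rw [mixture_def α', Finset.mul_sum, Finset.sum_div]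
    exact Finset.sum_congr rfl fun i _ => by ring
  rw [hlin, isSecondMoment_eq, isSecondMoment_eq, Finset.mul_sum, ← Finset.sum_sub_distrib]
  refine Finset.sum_le_sum fun ω _ => ?_
  by_cases hz : Z ω * P ω = 0
  · rw [hz]; simp
  · have hq' : mixture α' Q ω ≠ 0 := hadm' ω hz
    have hq'pos : 0 < mixture α' Q ω := lt_of_le_of_ne (mixture_nonneg' hα' hQ ω) (Ne.symm hq')
    exact tangent_ineq (sq_nonneg _) (mixture_nonneg' hα hQ ω) hq'pos

/-- **The stationarity condition certifies a GLOBAL minimum** (elementary consequence of convexity; the paper states the condition and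
a local argument): if `W_i(α) ≤ W(α)` for every channel `i` (in particular if `W_i(α) = W(α) ∀ i`, as printed), then `W(α) ≤ W(α′)` for
every weight vector `α′ ≥ 0`, `Σ α′ = 1` whose mixture charges the support of `f`. [cite: KleissPittau1994, §1 ("obtained for those values ᾱ for which W_i(ᾱ) = W(ᾱ) for all i")] -/
theorem isSecondMoment_le_of_channelMoment_le (hα : ∀ k, 0 ≤ α k) (hα' : ∀ k, 0 ≤ α' k) (hα'1 : ∑ k, α' k = 1)
    (hQ : ∀ k ω, 0 ≤ Q k ω) (hadm' : Admissible P (mixture α' Q) Z)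
    (hW : ∀ i, channelMoment α Q P Z i ≤ isSecondMoment P (mixture α Q) Z) :
    isSecondMoment P (mixture α Q) Z ≤ isSecondMoment P (mixture α' Q) Z := by
  have ht := isSecondMoment_mixture_ge_tangent hα hα' hQ hadm'
  have hs : ∑ i, α' i * channelMoment α Q P Z i ≤ isSecondMoment P (mixture α Q) Z := by
    calc ∑ i, α' i * channelMoment α Q P Z i ≤ ∑ i, α' i * isSecondMoment P (mixture α Q) Z :=
          Finset.sum_le_sum fun i _ => mul_le_mul_of_nonneg_left (hW i) (hα' i)
      _ = isSecondMoment P (mixture α Q) Z := by rw [← Finset.sum_mul, hα'1, one_mul]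
  linarith

/-- **A-posteriori certificate** (elementary): if every channel moment satisfies `W_i(α) ≤ M`, then no admissible weight vector in the
simplex does better than `2W(α) − M`, i.e. `W(α) − inf W ≤ M − W(α)`. [cite: KleissPittau1994, §2–§3 (the iteration monitors the W_i)] -/
theorem isSecondMoment_mixture_ge_of_channelMoment_le (hα : ∀ k, 0 ≤ α k) (hα' : ∀ k, 0 ≤ α' k) (hα'1 : ∑ k, α' k = 1)
    (hQ : ∀ k ω, 0 ≤ Q k ω) (hadm' : Admissible P (mixture α' Q) Z) {M : ℝ} (hM : ∀ i, channelMoment α Q P Z i ≤ M) :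
    2 * isSecondMoment P (mixture α Q) Z - M ≤ isSecondMoment P (mixture α' Q) Z := by
  have ht := isSecondMoment_mixture_ge_tangent hα hα' hQ hadm'
  have hs : ∑ i, α' i * channelMoment α Q P Z i ≤ M := by
    calc ∑ i, α' i * channelMoment α Q P Z i ≤ ∑ i, α' i * M :=
          Finset.sum_le_sum fun i _ => mul_le_mul_of_nonneg_left (hM i) (hα' i)
      _ = M := by rw [← Finset.sum_mul, hα'1, one_mul]
  linarith

/-- **The printed discrepancy `D = max_{i,j} |W_i − W_j|` bounds the sub-optimality** (elementary): for `α` itself in the simplex,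
`|W_i(α) − W_j(α)| ≤ D ∀ i, j ⇒ W(α) − W(α′) ≤ D` for every admissible `α′` in the simplex — "D measures how well the set of α_i
approximates the behaviour of the optimal set", quantitatively. [cite: KleissPittau1994, §3 (display "D = max_{i,j}|W_i − W_j|")] -/
theorem isSecondMoment_sub_le_discrepancy (hα : ∀ k, 0 ≤ α k) (hα1 : ∑ k, α k = 1) (hα' : ∀ k, 0 ≤ α' k)
    (hα'1 : ∑ k, α' k = 1) (hQ : ∀ k ω, 0 ≤ Q k ω) (hadm' : Admissible P (mixture α' Q) Z) {D : ℝ}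
    (hD : ∀ i j, |channelMoment α Q P Z i - channelMoment α Q P Z j| ≤ D) :
    isSecondMoment P (mixture α Q) Z - isSecondMoment P (mixture α' Q) Z ≤ D := by
  set W := isSecondMoment P (mixture α Q) Z with hWdef
  -- every W_i ≤ W + D, because W = Σ_j α_j W_j is an average of the W_j
  have hM : ∀ i, channelMoment α Q P Z i ≤ W + D := by
    intro i
    have heuler := sum_mul_channelMoment α Q P Z
    have h1 : channelMoment α Q P Z i - W = ∑ j, α j * (channelMoment α Q P Z i - channelMoment α Q P Z j) := by
      simp only [mul_sub, Finset.sum_sub_distrib]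
      rw [← Finset.sum_mul, hα1, one_mul, heuler]
    have h2 : ∑ j, α j * (channelMoment α Q P Z i - channelMoment α Q P Z j) ≤ ∑ j, α j * D :=
      Finset.sum_le_sum fun j _ => mul_le_mul_of_nonneg_left ((le_abs_self _).trans (hD i j)) (hα j)
    rw [← Finset.sum_mul, hα1, one_mul] at h2
    linarith
  have h := isSecondMoment_mixture_ge_of_channelMoment_le hα hα' hα'1 hQ hadm' hM
  linarith

/-! #### The dependent case `f = Σ_i γ_i g_i` -/

omit [Fintype Ω] in
/-- In the dependent case `f p = Σ_i γ_i g_i` with `ᾱ = γ/Σγ`, the multichannel density is `g_ᾱ = f p / Σγ` pointwise (both sides `0`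
when `Σγ = 0`, by Lean's `x/0 = 0`). [cite: KleissPittau1994, §1 ("suppose that f(x) is dependent with the set g_i(x) … ᾱ_k = γ_k/Σ_i γ_i")] -/
theorem mixture_dependent {γ : ι → ℝ} (hf : ∀ ω, Z ω * P ω = ∑ i, γ i * Q i ω) (ω : Ω) :
    mixture (fun i => γ i / ∑ j, γ j) Q ω = Z ω * P ω / ∑ j, γ j := by
  rw [mixture_def, hf ω, Finset.sum_div]
  exact Finset.sum_congr rfl fun i _ => by ring

/-- **Dependent case, `W(ᾱ) = (Σ_i γ_i)²`** (channels are probability vectors). [cite: KleissPittau1994, §1 ("in which case W_k(α) = W(α) = (Σ_i γ_i)²")] -/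
theorem isSecondMoment_dependent {γ : ι → ℝ} (hQ1 : ∀ k, ∑ ω, Q k ω = 1)
    (hf : ∀ ω, Z ω * P ω = ∑ i, γ i * Q i ω) (hγ : ∑ i, γ i ≠ 0) :
    isSecondMoment P (mixture (fun i => γ i / ∑ j, γ j) Q) Z = (∑ i, γ i) ^ 2 := by
  rw [isSecondMoment_eq]
  simp_rw [mixture_dependent hf]
  have hI : ∑ ω, Z ω * P ω = ∑ i, γ i := by
    simp_rw [hf]
    rw [Finset.sum_comm]
    exact Finset.sum_congr rfl fun i _ => by rw [← Finset.mul_sum, hQ1 i, mul_one]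
  have hterm : ∀ ω, (Z ω * P ω) ^ 2 / (Z ω * P ω / ∑ j, γ j) = (∑ j, γ j) * (Z ω * P ω) := by
    intro ω
    by_cases hz : Z ω * P ω = 0
    · rw [hz]; simp
    · field_simp
  simp_rw [hterm]
  rw [← Finset.mul_sum, hI, sq]

/-- **Dependent case, `W_k(ᾱ) = (Σ_i γ_i)²`** for every channel with `γ_k > 0` (all `γ_i ≥ 0`, channels probability vectors `≥ 0`) — so
the stationarity condition `W_k = W` holds at `ᾱ`. [cite: KleissPittau1994, §1 ("in which case W_k(α) = W(α) = (Σ_i γ_i)²")] -/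
theorem channelMoment_dependent {γ : ι → ℝ} (hγnn : ∀ i, 0 ≤ γ i) (hQ : ∀ k ω, 0 ≤ Q k ω) (hQ1 : ∀ k, ∑ ω, Q k ω = 1)
    (hf : ∀ ω, Z ω * P ω = ∑ i, γ i * Q i ω) {k : ι} (hγk : 0 < γ k) :
    channelMoment (fun i => γ i / ∑ j, γ j) Q P Z k = (∑ i, γ i) ^ 2 := by
  have hγpos : 0 < ∑ i, γ i :=
    lt_of_lt_of_le hγk (Finset.single_le_sum (fun i _ => hγnn i) (Finset.mem_univ k))
  have hγ : ∑ i, γ i ≠ 0 := hγpos.ne'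
  unfold channelMoment
  simp_rw [mixture_dependent hf]
  -- where f p = 0 the channel k carries no mass (γ_k > 0), elsewhere the summand is (Σγ)² Q_k
  have hterm : ∀ ω, (Z ω * P ω) ^ 2 * Q k ω / (Z ω * P ω / ∑ j, γ j) ^ 2 = (∑ j, γ j) ^ 2 * Q k ω := by
    intro ω
    by_cases hz : Z ω * P ω = 0
    · have hle : γ k * Q k ω ≤ ∑ i, γ i * Q i ω :=
        Finset.single_le_sum (fun i _ => mul_nonneg (hγnn i) (hQ i ω)) (Finset.mem_univ k)
      rw [← hf ω, hz] at hle
      have hq0 : Q k ω = 0 :=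
        le_antisymm (nonpos_of_mul_nonpos_right (hle) hγk) (hQ k ω)
      rw [hz, hq0]; simp
    · have hz' : Z ω * P ω ≠ 0 := hz
      have hz2 : (Z ω * P ω) ^ 2 ≠ 0 := pow_ne_zero 2 hz'
      rw [div_pow, div_div_eq_mul_div, mul_assoc, mul_div_cancel_left₀ _ hz2, mul_comm]
  simp_rw [hterm]
  rw [← Finset.mul_sum, hQ1 k, mul_one]

/-- **Dependent case, zero variance**: "Of course, in this case the Monte Carlo error is zero" — `W(ᾱ) − I² = 0`.
[cite: KleissPittau1994, §1] -/
theorem isVariance_dependent {γ : ι → ℝ} (hQ1 : ∀ k, ∑ ω, Q k ω = 1)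
    (hf : ∀ ω, Z ω * P ω = ∑ i, γ i * Q i ω) (hγ : ∑ i, γ i ≠ 0) :
    isVariance P (mixture (fun i => γ i / ∑ j, γ j) Q) Z = 0 := by
  have hadm : Admissible P (mixture (fun i => γ i / ∑ j, γ j) Q) Z := by
    intro ω hz hq
    rw [mixture_dependent hf, div_eq_zero_iff] at hq
    rcases hq with h | h
    · exact hz h
    · exact hγ h
  have hI : ∑ ω, Z ω * P ω = ∑ i, γ i := by
    simp_rw [hf]
    rw [Finset.sum_comm]
    exact Finset.sum_congr rfl fun i _ => by rw [← Finset.mul_sum, hQ1 i, mul_one]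
  unfold isVariance
  rw [isMean_eq hadm, isSecondMoment_dependent hQ1 hf hγ, hI, sub_self]

end KleissPittau

section Stratified

/-! ### The stratified case (Kleiss–Pittau §1–§2): disjoint channels, `W_i(α) = c_i/α_i²`, the update `α_i √W_i ∝ √c_i` is immediately optimal

VERBATIM [KleissPittau1994] §1: "A second case of interest is that of stratified sampling. This is described, in our formalism, by a set
of channels g_i(x) that each restrict the values x to a piece of phase space, a bin. The bins must be disjoint and together make up the
whole phase space volume. … In that case, W_i(α) = (1/α_i²) ∫ dx f(x)² θ_i(x)/g_i(x), and we recover the well-known result [james] that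
the error is minimized if each bin contributes the same amount to the total variance." §2: "In the case of stratified sampling, the
optimum was reached when W_i(α) = c α_i^{−2}, with some constant c independent of i. This implies that, supposing the idealized case where
each W_i(α) is estimated with zero error …, the choice of new α_i according to α_i^{new} ∝ α_i √(W_i(α)) will give immediately the optimal
set ᾱ, irrespective of the choice of the initial set α_i."
TYPING: disjoint supports `Q i ω · Q j ω = 0` (`i ≠ j`); the bin constants `c_i = Σ_ω (Z P)²/Q_i` (the sum runs over the support of `Q_i`
by Lean's `x/0 = 0`). PROVED: `W_i(α) = c_i/α_i²` (`channelMoment_stratified`), `W(α) = Σ_i c_i/α_i` (`isSecondMoment_stratified`), the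
update is `α_i √W_i(α) = √c_i` whatever `α` (`mul_sqrt_channelMoment_stratified`), and optimality of `ᾱ ∝ √c` by Cauchy–Schwarz (the
tree's Cochran/Stuart inequality `sq_sum_le_varPrime_mul_sum`): `(Σ_i √c_i)² ≤ W(α)` on the open simplex (`sq_sum_sqrt_le_isSecondMoment_stratified`)
with equality at `ᾱ` (`isSecondMoment_stratified_opt`). -/

variable {α : ι → ℝ} {Q : ι → Ω → ℝ} {P Z : Ω → ℝ}

omit [Fintype Ω] in
/-- On the support of bin `i` the multichannel density is `α_i g_i` (disjoint bins). [cite: KleissPittau1994, §1 (stratified case)] -/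
theorem mixture_stratified (hdisj : ∀ i j ω, i ≠ j → Q i ω * Q j ω = 0) {i : ι} {ω : Ω} (hq : Q i ω ≠ 0) :
    mixture α Q ω = α i * Q i ω := by
  rw [mixture_def]
  refine Finset.sum_eq_single i (fun j _ hj => ?_) (fun h => absurd (Finset.mem_univ i) h)
  have h0 : Q i ω * Q j ω = 0 := hdisj i j ω (Ne.symm hj)
  rcases mul_eq_zero.mp h0 with h | h
  · exact absurd h hq
  · rw [h, mul_zero]

/-- **`W_i(α) = (1/α_i²) ∫ f² θ_i/g_i`** for disjoint bins (`α_i ≠ 0`): `channelMoment = c_i/α_i²`, `c_i = Σ (Z P)²/Q_i`.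
[cite: KleissPittau1994, §1 (display "W_i(α) = (1/α_i²)∫dx f(x)²θ_i(x)/g_i(x)")] -/
theorem channelMoment_stratified (hdisj : ∀ i j ω, i ≠ j → Q i ω * Q j ω = 0) {i : ι} (hαi : α i ≠ 0) :
    channelMoment α Q P Z i = (∑ ω, (Z ω * P ω) ^ 2 / Q i ω) / α i ^ 2 := by
  rw [channelMoment_def, Finset.sum_div]
  refine Finset.sum_congr rfl fun ω _ => ?_
  by_cases hq : Q i ω = 0
  · rw [hq]; simp
  · rw [mixture_stratified hdisj hq]
    field_simp

/-- **`W(α) = Σ_i c_i/α_i`** for disjoint bins and weights `α_i ≠ 0` (Euler's identity with `W_i = c_i/α_i²`).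
[cite: KleissPittau1994, §1–§2 (stratified case, "W_i(α) = c α_i^{−2}")] -/
theorem isSecondMoment_stratified (hdisj : ∀ i j ω, i ≠ j → Q i ω * Q j ω = 0) (hα : ∀ i, α i ≠ 0) :
    isSecondMoment P (mixture α Q) Z = ∑ i, (∑ ω, (Z ω * P ω) ^ 2 / Q i ω) / α i := by
  rw [← sum_mul_channelMoment]
  refine Finset.sum_congr rfl fun i _ => ?_
  rw [channelMoment_stratified hdisj (hα i)]
  field_simp

/-- **The update `α_i^{new} ∝ α_i √W_i(α)` is `∝ √c_i`, "irrespective of the choice of the initial set"** (disjoint bins `≥ 0`, `α_i > 0`).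
[cite: KleissPittau1994, §2 ("the choice of new α_i according to α_i ∝ α_i √(W_i(α)) will give immediately the optimal set ᾱ")] -/
theorem mul_sqrt_channelMoment_stratified (hdisj : ∀ i j ω, i ≠ j → Q i ω * Q j ω = 0) (hQ : ∀ k ω, 0 ≤ Q k ω)
    {i : ι} (hαi : 0 < α i) :
    α i * Real.sqrt (channelMoment α Q P Z i) = Real.sqrt (∑ ω, (Z ω * P ω) ^ 2 / Q i ω) := by
  have hc : 0 ≤ ∑ ω, (Z ω * P ω) ^ 2 / Q i ω := Finset.sum_nonneg fun ω _ => div_nonneg (sq_nonneg _) (hQ i ω)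
  rw [channelMoment_stratified hdisj hαi.ne', Real.sqrt_div hc, Real.sqrt_sq hαi.le]
  field_simp

/-- **Optimality of `ᾱ ∝ √c`, lower bound** ("the error is minimized if each bin contributes the same amount to the total variance"):
for disjoint bins `≥ 0` and any weights `α_i > 0` with `Σ α_i = 1`, `(Σ_i √c_i)² ≤ W(α)` — Cauchy–Schwarz, via the tree's
Cochran–Stuart inequality. [cite: KleissPittau1994, §1–§2 (stratified case); Cochran1963, §5.5 Thm 5.6] -/
theorem sq_sum_sqrt_le_isSecondMoment_stratified (hdisj : ∀ i j ω, i ≠ j → Q i ω * Q j ω = 0) (hQ : ∀ k ω, 0 ≤ Q k ω)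
    (hα : ∀ i, 0 < α i) (hα1 : ∑ i, α i = 1) :
    (∑ i, Real.sqrt (∑ ω, (Z ω * P ω) ^ 2 / Q i ω)) ^ 2 ≤ isSecondMoment P (mixture α Q) Z := by
  have hc : ∀ i, 0 ≤ ∑ ω, (Z ω * P ω) ^ 2 / Q i ω := fun i => Finset.sum_nonneg fun ω _ => div_nonneg (sq_nonneg _) (hQ i ω)
  have h := Literature.Probability.StratifiedSampling.sq_sum_le_varPrime_mul_sum
    (fun i => Real.sqrt (∑ ω, (Z ω * P ω) ^ 2 / Q i ω)) α hα
  rw [Literature.Probability.StratifiedSampling.varPrime_def, hα1, mul_one] at h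
  rw [isSecondMoment_stratified hdisj fun i => (hα i).ne']
  refine h.trans (le_of_eq (Finset.sum_congr rfl fun i _ => ?_))
  rw [Real.sq_sqrt (hc i)]

/-- **… with equality at `ᾱ_i = √c_i / Σ_j √c_j`**: `W(ᾱ) = (Σ_i √c_i)²` (disjoint bins, all `c_i > 0`, at least one channel).
[cite: KleissPittau1994, §2 ("will give immediately the optimal set ᾱ")] -/
theorem isSecondMoment_stratified_opt [Nonempty ι] (hdisj : ∀ i j ω, i ≠ j → Q i ω * Q j ω = 0)
    (hc : ∀ i, 0 < ∑ ω, (Z ω * P ω) ^ 2 / Q i ω) :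
    isSecondMoment P
        (mixture (fun i => Real.sqrt (∑ ω, (Z ω * P ω) ^ 2 / Q i ω) / ∑ j, Real.sqrt (∑ ω, (Z ω * P ω) ^ 2 / Q j ω)) Q) Z
      = (∑ i, Real.sqrt (∑ ω, (Z ω * P ω) ^ 2 / Q i ω)) ^ 2 := by
  set r : ι → ℝ := fun i => Real.sqrt (∑ ω, (Z ω * P ω) ^ 2 / Q i ω) with hr
  have hrpos : ∀ i, 0 < r i := fun i => Real.sqrt_pos.mpr (hc i)
  have hS : 0 < ∑ j, r j := by
    obtain ⟨i⟩ := ‹Nonempty ι›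
    exact lt_of_lt_of_le (hrpos i) (Finset.single_le_sum (fun j _ => (hrpos j).le) (Finset.mem_univ i))
  have hα : ∀ i, (fun i => r i / ∑ j, r j) i ≠ 0 := fun i => (div_pos (hrpos i) hS).ne'
  rw [isSecondMoment_stratified hdisj hα]
  have hterm : ∀ i, (∑ ω, (Z ω * P ω) ^ 2 / Q i ω) / (r i / ∑ j, r j) = r i * ∑ j, r j := by
    intro i
    have hsq : ∑ ω, (Z ω * P ω) ^ 2 / Q i ω = r i ^ 2 := by
      rw [hr]; exact (Real.sq_sqrt (hc i).le).symm
    rw [hsq]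
    field_simp [(hrpos i).ne', hS.ne']
  simp_rw [hterm]
  rw [← Finset.sum_mul, sq]

end Stratified

end Literature.Probability.ImportanceSampling
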